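import Mathlib
import Summits.Ventures.PercRepro2.Defs
import Summits.Ventures.PercRepro2.Independence
import Summits.Ventures.PercRepro2.Harris
import Summits.Ventures.PercRepro2.ZCTwoEdge
import Summits.Ventures.PercRepro2.ZCLeafRoot
import Summits.Ventures.PercRepro2.ZCRootOWCert
import Summits.Ventures.PercRepro2.ZCA3WTypes
import Summits.Ventures.PercRepro2.ZCRootOWCells

/-!
# Theorem H (MINE-A.md §70.8), abstract form — (ZC) when the root `a₁` has degree two with
neighbours `o` and a non-mark `w`, from (ZC) on `G − a₁` for the marks `(w, a₃, o)`
(blind cell PercRepro2, mine-a g24)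

Abstract setting: two distinct edges `f₁` (weight `p f₁`), `f₂` (weight `p f₂`) and eight events of
the configuration space that ignore `f₁`, `f₂` — in the graph instance (`ZCRootOWGraph.lean`) they
are the events of `G − a₁`: `A = {o ↔ a₃}`, `W = {o ↔ w}`, `Γ = {w ↔ a₃}`, and the cluster events
`YK = {{a₁} ∪ C(o) ∈ 𝒰}`, `YW = {{a₁} ∪ C(w) ∈ 𝒰}`, `YB = {{a₁} ∪ C(o) ∪ C(w) ∈ 𝒰}`,
`YX = {{a₁} ∪ C(a₃) ∈ 𝒰}`, `YXK = {{a₁} ∪ C(a₃) ∪ C(o) ∈ 𝒰}` (`{a₁} ∉ 𝒰`; the last two enter only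
through the certificate's Harris atoms).  The five types of `(o, a₃, w)` are `T₁ = A ∩ W`,
`T₂ = A ∩ Wᶜ`, `T₃ = Aᶜ ∩ W`, `T₄ = Aᶜ ∩ Wᶜ ∩ Γ`, `T₅ = Aᶜ ∩ Wᶜ ∩ Γᶜ` (`ZCA3WTypes`); the four (ZC)
events are `e = ({f₁ open} ∩ A) ∪ ({f₂ open} ∩ Γ)`, `L = {f₁ open} ∪ ({f₂ open} ∩ W)`, `γ = A ∪ (e ∩ L)`,
`U = ({f₁ open, f₂ closed} ∩ YK) ∪ ({f₁ closed, f₂ open} ∩ YW) ∪ ({f₁, f₂ open} ∩ YB)`.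

**Theorem** (`zc_rootow`): with the eight events increasing, the transitivity relations, the inclusions
`YK ⊆ YB`, `YW ⊆ YB`, `YK ⊆ YXK`, the coincidences `YK ∩ W = YW ∩ W = YB ∩ W`, `YX ∩ A = YXK ∩ A = YK ∩ A`,
`YX ∩ Γ = YW ∩ Γ`, `YXK ∩ Γ = YB ∩ Γ`, lemma (P1) `P(T₂) P(T₄) ≤ P(T₁) P(T₅)` (middle vertex `a₃`) and the
inductive hypothesis `(ZC)(Γ, W, A; YW) ≥ 0` (= (ZC) on `G − a₁` for the marks `(w, a₃, o)`),
(ZC) `P(D) Cov(U, eL) − P(B) Cov(U, e¬L) ≥ 0`.  The (W1) atom is supplied by `w1_nonneg`; the kernel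
certificate is `zc_rootow_cert` (88 terms).  One seat.
-/

namespace Summit.Ventures.PercRepro2

section TheoremHAbstract

variable {E : Type*} [Fintype E] [DecidableEq E] {R : Type*} [CommRing R] [LinearOrder R]
  [IsStrictOrderedRing R]

/-- `P(Y ∩ (A ∪ W)ᶜ)` in type masses. -/
lemma prob_inter_compl_union_AW (p : E → R) {A W Γ : Set (Config E)} (Y : Set (Config E)) :
    prob p (Y ∩ (A ∪ W)ᶜ) = prob p (Y ∩ (Aᶜ ∩ Wᶜ ∩ Γ)) + prob p (Y ∩ (Aᶜ ∩ Wᶜ ∩ Γᶜ)) := by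
  have h1 := prob_inter_add_prob_inter_compl p Y (A ∪ W)
  have h2 := prob_inter_union_AW p (A := A) (W := W) Y
  have h3 := prob_eq_sum_five p A W Γ Y
  linarith

/-- **Theorem H, abstract form** — see the module docstring. -/
theorem zc_rootow {p : E → R} (hp : IsProbVec p) {f₁ f₂ : E} (hf : f₁ ≠ f₂)
    {A W Γ YK YW YB YX YXK : Set (Config E)}
    (hA : ∀ (ω : Config E) (b₁ b₂ : Bool),
      Function.update (Function.update ω f₁ b₁) f₂ b₂ ∈ A ↔ ω ∈ A)
    (hW : ∀ (ω : Config E) (b₁ b₂ : Bool),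
      Function.update (Function.update ω f₁ b₁) f₂ b₂ ∈ W ↔ ω ∈ W)
    (hΓ : ∀ (ω : Config E) (b₁ b₂ : Bool),
      Function.update (Function.update ω f₁ b₁) f₂ b₂ ∈ Γ ↔ ω ∈ Γ)
    (hYK : ∀ (ω : Config E) (b₁ b₂ : Bool),
      Function.update (Function.update ω f₁ b₁) f₂ b₂ ∈ YK ↔ ω ∈ YK)
    (hYW : ∀ (ω : Config E) (b₁ b₂ : Bool),
      Function.update (Function.update ω f₁ b₁) f₂ b₂ ∈ YW ↔ ω ∈ YW)
    (hYB : ∀ (ω : Config E) (b₁ b₂ : Bool),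
      Function.update (Function.update ω f₁ b₁) f₂ b₂ ∈ YB ↔ ω ∈ YB)
    (hAup : IsUpperSet A) (hWup : IsUpperSet W) (hΓup : IsUpperSet Γ)
    (hYKup : IsUpperSet YK) (hYWup : IsUpperSet YW) (hYBup : IsUpperSet YB)
    (hYXup : IsUpperSet YX) (hYXKup : IsUpperSet YXK)
    (hWΓ : ∀ ω, ω ∈ W → ω ∈ Γ → ω ∈ A) (hAW : ∀ ω, ω ∈ A → ω ∈ W → ω ∈ Γ)
    (hAΓ : ∀ ω, ω ∈ A → ω ∈ Γ → ω ∈ W)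
    (hKB : YK ⊆ YB) (hWB : YW ⊆ YB) (hKXK : YK ⊆ YXK)
    (hKW : YK ∩ W = YW ∩ W) (hWBW : YW ∩ W = YB ∩ W)
    (hXA : YX ∩ A = YK ∩ A) (hXKA : YXK ∩ A = YK ∩ A)
    (hXΓ : YX ∩ Γ = YW ∩ Γ) (hXKΓ : YXK ∩ Γ = YB ∩ Γ)
    (hP1 : prob p (A ∩ Wᶜ) * prob p (Aᶜ ∩ Wᶜ ∩ Γ) ≤ prob p (A ∩ W) * prob p (Aᶜ ∩ Wᶜ ∩ Γᶜ))
    (hZC : 0 ≤ prob p (Γᶜ ∩ Wᶜ ∩ Aᶜ) * (prob p (YW ∩ (Γ ∩ W)) - prob p YW * prob p (Γ ∩ W))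
      - prob p (Γᶜ ∩ Wᶜ ∩ A) * (prob p (YW ∩ (Γ ∩ Wᶜ)) - prob p YW * prob p (Γ ∩ Wᶜ))) :
    let e := (openEdge f₁ ∩ A) ∪ (openEdge f₂ ∩ Γ)
    let L := openEdge f₁ ∪ (openEdge f₂ ∩ W)
    let U := (openEdge f₁ ∩ closedEdge f₂ ∩ YK) ∪ (closedEdge f₁ ∩ openEdge f₂ ∩ YW)
      ∪ (openEdge f₁ ∩ openEdge f₂ ∩ YB)
    let γ := A ∪ (e ∩ L)
    0 ≤ prob p (eᶜ ∩ Lᶜ ∩ γᶜ) * (prob p (U ∩ (e ∩ L)) - prob p U * prob p (e ∩ L))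
      - prob p (eᶜ ∩ Lᶜ ∩ γ) * (prob p (U ∩ (e ∩ Lᶜ)) - prob p U * prob p (e ∩ Lᶜ)) := by
  intro e L U γ
  -- the cell expansions
  have PeL := rootow_prob_eL p hf hA hW hΓ
  have PenL := rootow_prob_enL p hf hA hW hΓ
  have PUeL := rootow_prob_UeL p hf hA hW hΓ hYK hYW hYB
  have PUenL := rootow_prob_UenL p hf (YK := YK) (YB := YB) hA hW hΓ hYW
  have PU := rootow_prob_U p hf hYK hYW hYB
  have PB := rootow_prob_B p hf hA hW hΓ
  have PD := rootow_prob_D p hf hA hW hΓ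
  -- the type sets in the cells, in the canonical form
  have sΓW : Γ ∩ W = A ∩ W := by
    ext ω; have h1 := hWΓ ω; have h2 := hAW ω
    simp only [Set.mem_inter_iff] at h1 h2 ⊢; tauto
  have sΓWc : Γ ∩ Wᶜ = Aᶜ ∩ Wᶜ ∩ Γ := by
    ext ω; have h1 := hAΓ ω
    simp only [Set.mem_inter_iff, Set.mem_compl_iff] at h1 ⊢; tauto
  have sΓcWcA : Γᶜ ∩ Wᶜ ∩ A = A ∩ Wᶜ := by
    ext ω; have h1 := hAW ω
    simp only [Set.mem_inter_iff, Set.mem_compl_iff] at h1 ⊢; tauto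
  have sΓcWcAc : Γᶜ ∩ Wᶜ ∩ Aᶜ = Aᶜ ∩ Wᶜ ∩ Γᶜ := by
    ext ω; simp only [Set.mem_inter_iff, Set.mem_compl_iff]; tauto
  rw [sΓW] at PeL PUeL
  rw [sΓWc] at PenL PUenL
  rw [sΓcWcA] at PB
  rw [sΓcWcAc] at PD
  rw [sΓW, sΓWc, sΓcWcA, sΓcWcAc] at hZC
  -- the coincidences
  have coin : ∀ {X Y Z : Set (Config E)}, X ∩ Z = Y ∩ Z → ∀ S : Set (Config E),
      prob p (Y ∩ (S ∩ Z)) = prob p (X ∩ (S ∩ Z)) := by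
    intro X Y Z h S
    rw [← Set.inter_assoc, ← Set.inter_assoc, Set.inter_comm Y S, Set.inter_comm X S,
      Set.inter_assoc, Set.inter_assoc, h]
  have coinL : ∀ {X Y Z : Set (Config E)}, X ∩ Z = Y ∩ Z → ∀ S : Set (Config E),
      prob p (Y ∩ (Z ∩ S)) = prob p (X ∩ (Z ∩ S)) := by
    intro X Y Z h S
    rw [← Set.inter_assoc, ← Set.inter_assoc, h]
  have cW1 := coin hKW A
  have cW3 := coin hKW Aᶜ
  have cB1 := coin hWBW A
  have cB3 := coin hWBW Aᶜ
  rw [cW1] at cB1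
  rw [cW3] at cB3
  have cX1 := coinL hXA.symm W
  have cX2 := coinL hXA.symm Wᶜ
  have cXK1 := coinL hXKA.symm W
  have cXK2 := coinL hXKA.symm Wᶜ
  have cX4 := coin hXΓ.symm (Aᶜ ∩ Wᶜ)
  have cXK4 := coin hXKΓ.symm (Aᶜ ∩ Wᶜ)
  -- type probabilities
  have hsum := prob_eq_sum_five p A W Γ Set.univ
  simp only [Set.univ_inter, prob_univ] at hsum
  have PAΓ := prob_inter_union_AΓ p hWΓ Set.univ
  have PA := prob_inter_A p (A := A) (W := W) Set.univ
  have PAc := prob_inter_Ac p (A := A) (W := W) (Γ := Γ) Set.univ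
  have PAW := prob_inter_union_AW p (A := A) (W := W) Set.univ
  have PΓ := prob_inter_Γ p hWΓ hAW hAΓ Set.univ
  have PAWc := prob_inter_compl_union_AW p (A := A) (W := W) (Γ := Γ) Set.univ
  simp only [Set.univ_inter] at PAΓ PA PAc PAW PΓ PAWc
  -- masses
  have MYB := prob_eq_sum_five p A W Γ YB
  rw [cB1, cB3] at MYB
  have MYK := prob_eq_sum_five p A W Γ YK
  have MYW := prob_eq_sum_five p A W Γ YW
  rw [cW1, cW3] at MYW
  have MYX := prob_eq_sum_five p A W Γ YX
  rw [cX1, cX2, cX4] at MYX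
  have MYXK := prob_eq_sum_five p A W Γ YXK
  rw [cXK1, cXK2, cXK4] at MYXK
  have MYKA := prob_inter_A p (A := A) (W := W) YK
  have MYKAW := prob_inter_union_AW p (A := A) (W := W) YK
  have MYKAΓ := prob_inter_union_AΓ p hWΓ YK
  have MYBA := prob_inter_A p (A := A) (W := W) YB
  rw [cB1] at MYBA
  have MYBAΓ := prob_inter_union_AΓ p hWΓ YB
  rw [cB1] at MYBAΓ
  have MYBΓ := prob_inter_Γ p hWΓ hAW hAΓ YB
  rw [cB1] at MYBΓ
  have MYXKA := prob_inter_A p (A := A) (W := W) YXK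
  rw [cXK1, cXK2] at MYXKA
  have MYXKAW := prob_inter_union_AW p (A := A) (W := W) YXK
  rw [cXK1, cXK2] at MYXKAW
  have MYWA := prob_inter_A p (A := A) (W := W) YW
  rw [cW1] at MYWA
  have MYXA := prob_inter_A p (A := A) (W := W) YX
  rw [cX1, cX2] at MYXA
  have MYWAWc := prob_inter_compl_union_AW p (A := A) (W := W) (Γ := Γ) YW
  -- Harris slacks (with `P(S) P(X)` in the certificate's order)
  have hT1up : IsUpperSet (A ∩ W) := hAup.inter hWup
  have hAWup : IsUpperSet (A ∪ W) := hAup.union hWup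
  have hAΓup : IsUpperSet (A ∪ Γ) := hAup.union hΓup
  have har : ∀ {X S : Set (Config E)}, IsUpperSet X → IsUpperSet S →
      0 ≤ prob p (X ∩ S) - prob p S * prob p X := fun hX hS => by
    rw [mul_comm]; exact sub_nonneg.2 (prob_mul_prob_le_prob_inter hp hX hS)
  have hHarKW_12 := har hYBup hAup
  have hHarKW_124 := har hYBup hAΓup
  have hHarKW_14 := har hYBup hΓup
  have hHarKX_12 := har hYXKup hAup
  have hHarKX_123 := har hYXKup hAWup
  have hHarK_1 := har hYKup hT1up
  have hHarK_12 := har hYKup hAup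
  have hHarK_123 := har hYKup hAWup
  have hHarK_124 := har hYKup hAΓup
  have hHarW_12 := har hYWup hAup
  have hHarX_12 := har hYXup hAup
  have hHarW_1 := har hYWup hT1up
  rw [MYB] at hHarKW_12 hHarKW_124 hHarKW_14
  rw [MYBA, PA] at hHarKW_12
  rw [MYBAΓ, PAΓ] at hHarKW_124
  rw [MYBΓ, PΓ] at hHarKW_14
  rw [MYXK] at hHarKX_12 hHarKX_123
  rw [MYXKA, PA] at hHarKX_12
  rw [MYXKAW, PAW] at hHarKX_123
  rw [MYK] at hHarK_1 hHarK_12 hHarK_123 hHarK_124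
  rw [MYKA, PA] at hHarK_12
  rw [MYKAW, PAW] at hHarK_123
  rw [MYKAΓ, PAΓ] at hHarK_124
  rw [MYW] at hHarW_12 hHarW_1
  rw [MYWA, PA] at hHarW_12
  rw [cW1] at hHarW_1
  rw [MYX] at hHarX_12
  rw [MYXA, PA] at hHarX_12
  -- Harris-mixed: `YW` against the decreasing `(A ∪ W)ᶜ`
  have hmix : prob p (YW ∩ (A ∪ W)ᶜ) ≤ prob p YW * prob p (A ∪ W)ᶜ := by
    have h := prob_inter_le_prob_mul_prob_of_isLowerSet hp hAWup.compl hYWup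
    rw [Set.inter_comm, mul_comm] at h
    exact h
  rw [MYWAWc, MYW, PAWc] at hmix
  -- monotonicity slacks
  have mono : ∀ {X Y : Set (Config E)} (T : Set (Config E)), X ⊆ Y →
      0 ≤ prob p (Y ∩ T) - prob p (X ∩ T) :=
    fun T h => sub_nonneg.2 (prob_mono hp (Set.inter_subset_inter_left _ h))
  have hy2KWX_y2W := mono (A ∩ Wᶜ) hWB
  have hy3KWX_y3KW := mono (Aᶜ ∩ W) hKXK
  have hy4KWX_y4K := mono (Aᶜ ∩ Wᶜ ∩ Γ) hKB
  have hy4KWX_y4WX := mono (Aᶜ ∩ Wᶜ ∩ Γ) hWB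
  have hy5KW_y5K := mono (Aᶜ ∩ Wᶜ ∩ Γᶜ) hKB
  have hy5KW_y5W := mono (Aᶜ ∩ Wᶜ ∩ Γᶜ) hWB
  have hy5KX_y5K := mono (Aᶜ ∩ Wᶜ ∩ Γᶜ) hKXK
  -- nonnegativity
  have hp0 := hp.nonneg f₁
  have hp1 : 0 ≤ 1 - p f₁ := sub_nonneg.2 (hp.le_one f₁)
  have hq0 := hp.nonneg f₂
  have hq1 : 0 ≤ 1 - p f₂ := sub_nonneg.2 (hp.le_one f₂)
  have hT1 : 0 ≤ prob p (A ∩ W) := prob_nonneg hp _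
  have hT2 : 0 ≤ prob p (A ∩ Wᶜ) := prob_nonneg hp _
  have hT3 : 0 ≤ prob p (Aᶜ ∩ W) := prob_nonneg hp _
  have hT4 : 0 ≤ prob p (Aᶜ ∩ Wᶜ ∩ Γ) := prob_nonneg hp _
  have hT5 : 0 ≤ prob p (Aᶜ ∩ Wᶜ ∩ Γᶜ) := prob_nonneg hp _
  have hy1KWX : 0 ≤ prob p (YK ∩ (A ∩ W)) := prob_nonneg hp _
  have hy2KWX : 0 ≤ prob p (YB ∩ (A ∩ Wᶜ)) := prob_nonneg hp _
  have hy2KX : 0 ≤ prob p (YK ∩ (A ∩ Wᶜ)) := prob_nonneg hp _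
  have hy2W : 0 ≤ prob p (YW ∩ (A ∩ Wᶜ)) := prob_nonneg hp _
  have hy3KW : 0 ≤ prob p (YK ∩ (Aᶜ ∩ W)) := prob_nonneg hp _
  have hy3X : 0 ≤ prob p (YX ∩ (Aᶜ ∩ W)) := prob_nonneg hp _
  have hy4K : 0 ≤ prob p (YK ∩ (Aᶜ ∩ Wᶜ ∩ Γ)) := prob_nonneg hp _
  have hy4KWX : 0 ≤ prob p (YB ∩ (Aᶜ ∩ Wᶜ ∩ Γ)) := prob_nonneg hp _
  have hy4WX : 0 ≤ prob p (YW ∩ (Aᶜ ∩ Wᶜ ∩ Γ)) := prob_nonneg hp _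
  have hy5K : 0 ≤ prob p (YK ∩ (Aᶜ ∩ Wᶜ ∩ Γᶜ)) := prob_nonneg hp _
  have hy5KX : 0 ≤ prob p (YXK ∩ (Aᶜ ∩ Wᶜ ∩ Γᶜ)) := prob_nonneg hp _
  have hy5W : 0 ≤ prob p (YW ∩ (Aᶜ ∩ Wᶜ ∩ Γᶜ)) := prob_nonneg hp _
  have hy5X : 0 ≤ prob p (YX ∩ (Aᶜ ∩ Wᶜ ∩ Γᶜ)) := prob_nonneg hp _
  -- (P1), the inductive atom and (W1) in the certificate's shape
  have hP1' : 0 ≤ prob p (A ∩ W) * prob p (Aᶜ ∩ Wᶜ ∩ Γᶜ) - prob p (A ∩ Wᶜ) * prob p (Aᶜ ∩ Wᶜ ∩ Γ) :=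
    sub_nonneg.2 hP1
  rw [cW1, MYW] at hZC
  have hP1w : 0 ≤ prob p (Aᶜ ∩ Wᶜ ∩ Γᶜ) * prob p (A ∩ W) - prob p (A ∩ Wᶜ) * prob p (Aᶜ ∩ Wᶜ ∩ Γ) := by
    linarith
  have hZw : 0 ≤ prob p (Aᶜ ∩ Wᶜ ∩ Γᶜ) * (prob p (YK ∩ (A ∩ W))
      - (prob p (YK ∩ (A ∩ W)) + prob p (YW ∩ (Aᶜ ∩ Wᶜ ∩ Γ)) + prob p (YK ∩ (Aᶜ ∩ W))
        + prob p (YW ∩ (A ∩ Wᶜ)) + prob p (YW ∩ (Aᶜ ∩ Wᶜ ∩ Γᶜ))) * prob p (A ∩ W))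
      - prob p (A ∩ Wᶜ) * (prob p (YW ∩ (Aᶜ ∩ Wᶜ ∩ Γ))
      - (prob p (YK ∩ (A ∩ W)) + prob p (YW ∩ (Aᶜ ∩ Wᶜ ∩ Γ)) + prob p (YK ∩ (Aᶜ ∩ W))
        + prob p (YW ∩ (A ∩ Wᶜ)) + prob p (YW ∩ (Aᶜ ∩ Wᶜ ∩ Γᶜ))) * prob p (Aᶜ ∩ Wᶜ ∩ Γ)) := by
    linear_combination hZC
  have hc1 : (prob p (YK ∩ (A ∩ W)) + prob p (YW ∩ (Aᶜ ∩ Wᶜ ∩ Γ)) + prob p (YK ∩ (Aᶜ ∩ W))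
        + prob p (YW ∩ (A ∩ Wᶜ)) + prob p (YW ∩ (Aᶜ ∩ Wᶜ ∩ Γᶜ))) * prob p (A ∩ W)
      ≤ prob p (YK ∩ (A ∩ W)) := by
    linear_combination hHarW_1
  have hmix' : prob p (YW ∩ (Aᶜ ∩ Wᶜ ∩ Γ)) + prob p (YW ∩ (Aᶜ ∩ Wᶜ ∩ Γᶜ))
      ≤ (prob p (YK ∩ (A ∩ W)) + prob p (YW ∩ (Aᶜ ∩ Wᶜ ∩ Γ)) + prob p (YK ∩ (Aᶜ ∩ W))
        + prob p (YW ∩ (A ∩ Wᶜ)) + prob p (YW ∩ (Aᶜ ∩ Wᶜ ∩ Γᶜ)))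
        * (prob p (Aᶜ ∩ Wᶜ ∩ Γ) + prob p (Aᶜ ∩ Wᶜ ∩ Γᶜ)) := by
    linear_combination hmix
  have hw1 := w1_nonneg (prob p (A ∩ W)) (prob p (Aᶜ ∩ Wᶜ ∩ Γ)) (prob p (Aᶜ ∩ W)) (prob p (A ∩ Wᶜ))
    (prob p (Aᶜ ∩ Wᶜ ∩ Γᶜ)) (prob p (YK ∩ (A ∩ W))) (prob p (YW ∩ (Aᶜ ∩ Wᶜ ∩ Γ)))
    (prob p (YK ∩ (Aᶜ ∩ W))) (prob p (YW ∩ (A ∩ Wᶜ))) (prob p (YW ∩ (Aᶜ ∩ Wᶜ ∩ Γᶜ)))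
    hT1 hT4 hT3 hT2 hT5 hy1KWX hy4WX hy3KW hy2W hy5W hP1w hZw hc1 hmix'
  have hW1 : 0 ≤ (prob p (Aᶜ ∩ Wᶜ ∩ Γ) + prob p (Aᶜ ∩ W)) * (prob p (YK ∩ (A ∩ W))
      - (prob p (YK ∩ (A ∩ W)) + prob p (YW ∩ (A ∩ Wᶜ)) + prob p (YK ∩ (Aᶜ ∩ W))
        + prob p (YW ∩ (Aᶜ ∩ Wᶜ ∩ Γ)) + prob p (YW ∩ (Aᶜ ∩ Wᶜ ∩ Γᶜ))) * prob p (A ∩ W))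
      - prob p (A ∩ W) * (prob p (YW ∩ (Aᶜ ∩ Wᶜ ∩ Γ))
      - (prob p (YK ∩ (A ∩ W)) + prob p (YW ∩ (A ∩ Wᶜ)) + prob p (YK ∩ (Aᶜ ∩ W))
        + prob p (YW ∩ (Aᶜ ∩ Wᶜ ∩ Γ)) + prob p (YW ∩ (Aᶜ ∩ Wᶜ ∩ Γᶜ))) * prob p (Aᶜ ∩ Wᶜ ∩ Γ))
      + (prob p (YK ∩ (A ∩ W)) + prob p (YW ∩ (A ∩ Wᶜ)) + prob p (YK ∩ (Aᶜ ∩ W))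
        + prob p (YW ∩ (Aᶜ ∩ Wᶜ ∩ Γ)) + prob p (YW ∩ (Aᶜ ∩ Wᶜ ∩ Γᶜ)))
        * (prob p (Aᶜ ∩ Wᶜ ∩ Γᶜ) * prob p (A ∩ W) - prob p (A ∩ Wᶜ) * prob p (Aᶜ ∩ Wᶜ ∩ Γ)) := by
    linear_combination hw1
  have hZC' : 0 ≤ prob p (Aᶜ ∩ Wᶜ ∩ Γᶜ) * (prob p (YK ∩ (A ∩ W))
      - (prob p (YK ∩ (A ∩ W)) + prob p (YW ∩ (A ∩ Wᶜ)) + prob p (YK ∩ (Aᶜ ∩ W))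
        + prob p (YW ∩ (Aᶜ ∩ Wᶜ ∩ Γ)) + prob p (YW ∩ (Aᶜ ∩ Wᶜ ∩ Γᶜ))) * prob p (A ∩ W))
      - prob p (A ∩ Wᶜ) * (prob p (YW ∩ (Aᶜ ∩ Wᶜ ∩ Γ))
      - (prob p (YK ∩ (A ∩ W)) + prob p (YW ∩ (A ∩ Wᶜ)) + prob p (YK ∩ (Aᶜ ∩ W))
        + prob p (YW ∩ (Aᶜ ∩ Wᶜ ∩ Γ)) + prob p (YW ∩ (Aᶜ ∩ Wᶜ ∩ Γᶜ))) * prob p (Aᶜ ∩ Wᶜ ∩ Γ)) := by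
    linear_combination hZC
  -- rewrite the goal into the masses
  rw [PeL, PUeL, PenL, PUenL, PU, PB, PD, PAΓ, PA, PAc, MYBAΓ, MYKA, cW1, MYB, MYK, MYW]
  -- the certificate
  have key := zc_rootow_cert (p f₁) (p f₂) (prob p (A ∩ W)) (prob p (A ∩ Wᶜ)) (prob p (Aᶜ ∩ W))
    (prob p (Aᶜ ∩ Wᶜ ∩ Γ)) (prob p (Aᶜ ∩ Wᶜ ∩ Γᶜ))
    (prob p (YK ∩ (A ∩ W))) (prob p (YB ∩ (A ∩ Wᶜ))) (prob p (YK ∩ (A ∩ Wᶜ))) (prob p (YW ∩ (A ∩ Wᶜ)))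
    (prob p (YK ∩ (Aᶜ ∩ W))) (prob p (YXK ∩ (Aᶜ ∩ W))) (prob p (YX ∩ (Aᶜ ∩ W)))
    (prob p (YK ∩ (Aᶜ ∩ Wᶜ ∩ Γ))) (prob p (YB ∩ (Aᶜ ∩ Wᶜ ∩ Γ))) (prob p (YW ∩ (Aᶜ ∩ Wᶜ ∩ Γ)))
    (prob p (YK ∩ (Aᶜ ∩ Wᶜ ∩ Γᶜ))) (prob p (YB ∩ (Aᶜ ∩ Wᶜ ∩ Γᶜ))) (prob p (YXK ∩ (Aᶜ ∩ Wᶜ ∩ Γᶜ)))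
    (prob p (YW ∩ (Aᶜ ∩ Wᶜ ∩ Γᶜ))) (prob p (YX ∩ (Aᶜ ∩ Wᶜ ∩ Γᶜ)))
    hp0 hp1 hq0 hq1 hT1 hT2 hT3 hT4 hT5 hsum.symm hHarKW_12 hHarKW_124 hHarKW_14 hHarKX_12
    hHarKX_123 hHarK_1 hHarK_12 hHarK_123 hHarK_124 hHarW_12 hHarX_12 hP1' hW1 hZC' hy1KWX hy2KWX
    hy2KWX_y2W hy2KX hy2W hy3KW hy3KWX_y3KW hy3X hy4K hy4KWX hy4KWX_y4K hy4KWX_y4WX hy4WX hy5K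
    hy5KW_y5K hy5KW_y5W hy5KX hy5KX_y5K hy5W hy5X
  refine le_of_le_of_eq key ?_
  ring

end TheoremHAbstract

end Summit.Ventures.PercRepro2
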